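import Mathlib
import HarnessLib
import Summits.NavierStokesRegularity.NavierStokesRegularity.Theorems.PoloidalWindowDoorLrcModEntireParallelWebsIdentity
import Summits.NavierStokesRegularity.NavierStokesRegularity.Theorems.PoloidalWindowDoorLrcModEntirePlanarCurveRigidity

/-!
# Route `PoloidalWindowDoor`, item `LrcModEntire` (stmt-NavierStokesRegularity-20428), cells (Q4-curved)/(Q4-sonic, curved) of the (TH) column —
# THE HUYGENS IDENTITY OVER A CURVED BASE BRANCH (Fermi-frame calculus along the web `W(s,z) = Γ(s) + G(s,z)·JΓ′(s) + z·e₂`)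

Cell ns-regularity-ideate, stub-worker seat ns-poloidal-K2-p2 g16 under the LEAD of item 20428 (ns-poloidal-K2-p3 g16);
`--supports stmt-NavierStokesRegularity-20428 --as helper`.  Memo `Cruxes/LrcModEntire/T2B-g16.md` §1–§2 («for a curved base web the same computation
in its Fermi frame»): the ¬line analogue of LEAD g16's `…ParallelWebsIdentity.huygens_identity` (brick P1 over a STRAIGHT branch).

Setting (class-free): `F : ℝ³ → ℝ` of class `C³`; a `C²` unit-speed branch `Γ` in the thread plane with Frenet law `Γ″ = k•JΓ′`
(`…PlanarCurveRigidity.deriv_deriv_eq_curvature_smul`, `J = rotJ`); a web function `G`, differentiable on the open region `ℝ × I`; the CURVED WEB MAP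
`W(s,z) = Γ(s) + G(s,z)·JΓ′(s) + z·e₂`.  Its derivative is `DW[h] = h₁(1 − k(s)G)·Γ′(s) + DG[h]·JΓ′(s) + h₂·e₂` (`fderiv_curvedWeb_apply`: the Fermi factor
`1 − kG`).  The six web identities — `∂_{JΓ′}F(W) = 0`, `∂_{Γ′}F(W) = 0` (horizontal criticality, from the web Fermat law), `F(W) = R(z)` (homogeneity (Q3∞)), the
ridge law `B(Γ′,Γ′) + B(JΓ′,JΓ′) = −κ(z)` and the slice law `B(e₂,e₂) = −μ(z)(B(Γ′,Γ′) + B(JΓ′,JΓ′))` for `B = D²F(W)` — give, differentiating along the web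
(the frame turns: `(JΓ′)′ = −kΓ′`, `Γ′′ = kJΓ′`, and the turning terms are killed by the OTHER criticality identity):

  ★ `curved_huygens_identity`:  **`κ(z)·(1 − kG)²·G_z² = (R″(z) − μ(z)κ(z))·((1 − kG)² + G_s²)`**

(at `k ≡ 0` this is LEAD's `κ G_z² = (R″ − μκ)(1 + G_s²)`).  Consumers: the weighted Grönwall step «Huygens ⇒ parallel webs over a curved branch»
(`…CurvedParallelWebs`, this seat, next) and the characteristic transport law on a curved sheet.
WHAT THIS IS NOT: not a claim about Navier–Stokes regularity — calculus for the hypothetical web of research cell (Q4); items 20428 / 19708 / 27893 OPEN.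
-/

noncomputable section

-- the summit and its single sub-problem share the name (CONVENTIONS §1), as in every Theorems file
set_option linter.dupNamespace false

namespace Summit.NavierStokesRegularity.NavierStokesRegularity.Theorems.PoloidalWindowDoorLrcModEntireCurvedWebHuygens

open Set Function Filter Topology
open scoped InnerProductSpace RealInnerProductSpace ContDiff
open Summit.NavierStokesRegularity.NavierStokesRegularity.Theorems.PoloidalWindowDoorLrcModEntireSheetFlattenTools
open Summit.NavierStokesRegularity.NavierStokesRegularity.Theorems.PoloidalWindowDoorLrcModEntireParallelWebsIdentity
open Summit.NavierStokesRegularity.NavierStokesRegularity.Theorems.PoloidalWindowDoorLrcModEntireRidgeGlobalBranchFrame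
open Summit.NavierStokesRegularity.NavierStokesRegularity.Theorems.PoloidalWindowDoorLrcModEntirePlanarCurveRigidity

/-! ### Part A — the pointwise algebra (Fermi factor `J = 1 − kG`) -/

/-- **The curved Huygens relation from the six web identities** (pure algebra).  With `b = B(ν,ν)`, `J = 1 − kG`:
`J·B(T,ν) + G_s b = 0`, `G_z b + B(e₂,ν) = 0`, `J·B(T,T) + G_s B(T,ν) = 0`, `B(T,T) + b = −κ`, `G_z B(e₂,ν) + B(e₂,e₂) = R″`,
`B(e₂,e₂) = −μ (B(T,T) + b)` ⇒ `κ J² G_z² = (R″ − μκ)(J² + G_s²)`. -/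
theorem curved_huygens_algebra {b Btn Bzn Btt Bzz Gs Gz J κ μ R2 : ℝ}
    (h1 : J * Btn + Gs * b = 0) (h2 : Gz * b + Bzn = 0) (h3 : J * Btt + Gs * Btn = 0) (h4 : Btt + b = -κ)
    (h5 : Gz * Bzn + Bzz = R2) (h6 : Bzz = -μ * (Btt + b)) :
    κ * J ^ 2 * Gz ^ 2 = (R2 - μ * κ) * (J ^ 2 + Gs ^ 2) := by
  -- `J² B(T,T) = G_s² b`, hence `−κ J² = (J² + G_s²) b`; and `G_z² (−b) = R″ − μκ`
  have hA : J ^ 2 * Btt = Gs ^ 2 * b := by linear_combination J * h3 - Gs * h1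
  have hB : -κ * J ^ 2 = (J ^ 2 + Gs ^ 2) * b := by linear_combination -(J ^ 2) * h4 + hA
  have hC : Gz ^ 2 * b = μ * κ - R2 := by linear_combination Gz * h2 - h5 + h6 - μ * h4
  linear_combination -(Gz ^ 2) * hB - (J ^ 2 + Gs ^ 2) * hC

/-! ### Part B — calculus along the curved web -/

section web

variable {Γ : ℝ → EuclideanSpace ℝ (Fin 3)} {k : ℝ → ℝ} {G : ℝ × ℝ → ℝ}

/-- `Jvec` (sheet files) and `rotJ` (branch files) are the same quarter turn. -/
theorem Jvec_eq_rotJ (e : EuclideanSpace ℝ (Fin 3)) : Jvec e = rotJ e := rfl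

/-- The moving frame along the base: `s ↦ Γ′(s)` and `s ↦ JΓ′(s)` lifted to the parameter plane `(s,z)`. -/
theorem hasFDerivAt_tangent_fst (hΓ : ContDiff ℝ 2 Γ)
    (hk : ∀ s, deriv (deriv Γ) s = k s • rotJ (deriv Γ s)) (p : ℝ × ℝ) :
    HasFDerivAt (fun q : ℝ × ℝ => deriv Γ q.1)
      ((ContinuousLinearMap.smulRight (1 : ℝ →L[ℝ] ℝ) (k p.1 • rotJ (deriv Γ p.1))).comp (ContinuousLinearMap.fst ℝ ℝ ℝ)) p := by
  have h := (hasDerivAt_of_contDiff_two hΓ p.1).2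
  rw [hk p.1] at h
  exact h.hasFDerivAt.comp p hasFDerivAt_fst

/-- The normal field lifted to the parameter plane: `D(q ↦ JΓ′(q₁))[h] = −h₁ k(s)·Γ′(s)`. -/
theorem hasFDerivAt_normal_fst (hΓ : ContDiff ℝ 2 Γ) (hpl : ∀ s, Γ s 2 = 0)
    (hk : ∀ s, deriv (deriv Γ) s = k s • rotJ (deriv Γ s)) (p : ℝ × ℝ) :
    HasFDerivAt (fun q : ℝ × ℝ => rotJ (deriv Γ q.1))
      ((ContinuousLinearMap.smulRight (1 : ℝ →L[ℝ] ℝ) (-(k p.1) • deriv Γ p.1)).comp (ContinuousLinearMap.fst ℝ ℝ ℝ)) p :=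
  (hasDerivAt_normal hΓ hpl hk p.1).hasFDerivAt.comp p hasFDerivAt_fst

/-- **Derivative of the curved web map** `W(q) = Γ(q₁) + G(q)·JΓ′(q₁) + q₂·e₂`. -/
theorem hasFDerivAt_curvedWeb (hΓ : ContDiff ℝ 2 Γ) (hpl : ∀ s, Γ s 2 = 0)
    (hk : ∀ s, deriv (deriv Γ) s = k s • rotJ (deriv Γ s)) {p : ℝ × ℝ} (hG : DifferentiableAt ℝ G p) :
    HasFDerivAt (fun q : ℝ × ℝ => Γ q.1 + G q • rotJ (deriv Γ q.1) + q.2 • e2)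
      ((ContinuousLinearMap.smulRight (1 : ℝ →L[ℝ] ℝ) (deriv Γ p.1)).comp (ContinuousLinearMap.fst ℝ ℝ ℝ) +
        (G p • (ContinuousLinearMap.smulRight (1 : ℝ →L[ℝ] ℝ) (-(k p.1) • deriv Γ p.1)).comp (ContinuousLinearMap.fst ℝ ℝ ℝ) +
          (fderiv ℝ G p).smulRight (rotJ (deriv Γ p.1))) +
        (ContinuousLinearMap.snd ℝ ℝ ℝ).smulRight e2) p := by
  have h1 : HasFDerivAt (fun q : ℝ × ℝ => Γ q.1)
      ((ContinuousLinearMap.smulRight (1 : ℝ →L[ℝ] ℝ) (deriv Γ p.1)).comp (ContinuousLinearMap.fst ℝ ℝ ℝ)) p :=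
    (hasDerivAt_of_contDiff_two hΓ p.1).1.hasFDerivAt.comp p hasFDerivAt_fst
  have h2 : HasFDerivAt (fun q : ℝ × ℝ => G q • rotJ (deriv Γ q.1))
      (G p • (ContinuousLinearMap.smulRight (1 : ℝ →L[ℝ] ℝ) (-(k p.1) • deriv Γ p.1)).comp (ContinuousLinearMap.fst ℝ ℝ ℝ) +
        (fderiv ℝ G p).smulRight (rotJ (deriv Γ p.1))) p :=
    hG.hasFDerivAt.smul (hasFDerivAt_normal_fst hΓ hpl hk p)
  have h3 : HasFDerivAt (fun q : ℝ × ℝ => q.2 • e2) ((ContinuousLinearMap.snd ℝ ℝ ℝ).smulRight e2) p :=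
    (ContinuousLinearMap.snd ℝ ℝ ℝ).hasFDerivAt.smul_const e2
  exact (h1.add h2).add h3

/-- The curved web map is differentiable where `G` is. -/
theorem differentiableAt_curvedWeb (hΓ : ContDiff ℝ 2 Γ) (hpl : ∀ s, Γ s 2 = 0)
    (hk : ∀ s, deriv (deriv Γ) s = k s • rotJ (deriv Γ s)) {p : ℝ × ℝ} (hG : DifferentiableAt ℝ G p) :
    DifferentiableAt ℝ (fun q : ℝ × ℝ => Γ q.1 + G q • rotJ (deriv Γ q.1) + q.2 • e2) p :=
  (hasFDerivAt_curvedWeb hΓ hpl hk hG).differentiableAt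

/-- **The Fermi form of the derivative:** `DW(p)[h] = (h₁(1 − k(s)G(p)))·Γ′(s) + DG(p)[h]·JΓ′(s) + h₂·e₂`. -/
theorem fderiv_curvedWeb_apply (hΓ : ContDiff ℝ 2 Γ) (hpl : ∀ s, Γ s 2 = 0)
    (hk : ∀ s, deriv (deriv Γ) s = k s • rotJ (deriv Γ s)) {p : ℝ × ℝ} (hG : DifferentiableAt ℝ G p) (h : ℝ × ℝ) :
    fderiv ℝ (fun q : ℝ × ℝ => Γ q.1 + G q • rotJ (deriv Γ q.1) + q.2 • e2) p h =
      (h.1 * (1 - k p.1 * G p)) • deriv Γ p.1 + fderiv ℝ G p h • rotJ (deriv Γ p.1) + h.2 • e2 := by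
  rw [(hasFDerivAt_curvedWeb hΓ hpl hk hG).fderiv]
  simp only [_root_.add_apply, ContinuousLinearMap.comp_apply, ContinuousLinearMap.coe_fst',
    ContinuousLinearMap.smulRight_apply, _root_.smul_apply, ContinuousLinearMap.coe_snd', smul_smul]
  simp only [ContinuousLinearMap.one_def, ContinuousLinearMap.id_apply]
  module

/-- Chain rule along the curved web for a differentiable scalar `g`. -/
theorem fderiv_comp_curvedWeb (hΓ : ContDiff ℝ 2 Γ) (hpl : ∀ s, Γ s 2 = 0)
    (hk : ∀ s, deriv (deriv Γ) s = k s • rotJ (deriv Γ s)) {p : ℝ × ℝ} (hG : DifferentiableAt ℝ G p)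
    {g : EuclideanSpace ℝ (Fin 3) → ℝ} (hg : DifferentiableAt ℝ g (Γ p.1 + G p • rotJ (deriv Γ p.1) + p.2 • e2)) (h : ℝ × ℝ) :
    fderiv ℝ (fun q : ℝ × ℝ => g (Γ q.1 + G q • rotJ (deriv Γ q.1) + q.2 • e2)) p h =
      fderiv ℝ g (Γ p.1 + G p • rotJ (deriv Γ p.1) + p.2 • e2)
        ((h.1 * (1 - k p.1 * G p)) • deriv Γ p.1 + fderiv ℝ G p h • rotJ (deriv Γ p.1) + h.2 • e2) := by
  have hc := hg.hasFDerivAt.comp p (hasFDerivAt_curvedWeb hΓ hpl hk hG)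
  rw [show (fun q : ℝ × ℝ => g (Γ q.1 + G q • rotJ (deriv Γ q.1) + q.2 • e2)) =
      g ∘ (fun q : ℝ × ℝ => Γ q.1 + G q • rotJ (deriv Γ q.1) + q.2 • e2) from rfl, hc.fderiv,
    ContinuousLinearMap.comp_apply, ← fderiv_curvedWeb_apply hΓ hpl hk hG h,
    (hasFDerivAt_curvedWeb hΓ hpl hk hG).fderiv]

/-- **Derivative of a MOVING first derivative along the web**: for `F ∈ C²` and the frame field `V ∈ {Γ′, JΓ′}` (any field `V(q₁)` with a
known derivative `V′`), `D(q ↦ DF(W q)[V(q₁)])[h] = D²F(W)[DW h, V] + h₁·DF(W)[V′(s)]`. -/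
theorem fderiv_moving_deriv (hΓ : ContDiff ℝ 2 Γ) (hpl : ∀ s, Γ s 2 = 0)
    (hk : ∀ s, deriv (deriv Γ) s = k s • rotJ (deriv Γ s)) {p : ℝ × ℝ} (hG : DifferentiableAt ℝ G p)
    {F : EuclideanSpace ℝ (Fin 3) → ℝ} (hF : ContDiff ℝ 2 F)
    {V : ℝ → EuclideanSpace ℝ (Fin 3)} {V' : EuclideanSpace ℝ (Fin 3)} (hV : HasDerivAt V V' p.1) (h : ℝ × ℝ) :
    fderiv ℝ (fun q : ℝ × ℝ => fderiv ℝ F (Γ q.1 + G q • rotJ (deriv Γ q.1) + q.2 • e2) (V q.1)) p h =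
      fderiv ℝ (fderiv ℝ F) (Γ p.1 + G p • rotJ (deriv Γ p.1) + p.2 • e2)
          ((h.1 * (1 - k p.1 * G p)) • deriv Γ p.1 + fderiv ℝ G p h • rotJ (deriv Γ p.1) + h.2 • e2) (V p.1) +
        h.1 * fderiv ℝ F (Γ p.1 + G p • rotJ (deriv Γ p.1) + p.2 • e2) V' := by
  set W : ℝ × ℝ → EuclideanSpace ℝ (Fin 3) := fun q => Γ q.1 + G q • rotJ (deriv Γ q.1) + q.2 • e2 with hW
  have hDF : ∀ y, DifferentiableAt ℝ (fderiv ℝ F) y := fun y =>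
    ((hF.fderiv_right (m := 1) (by norm_num)).differentiable (by norm_num)) y
  have hWd : DifferentiableAt ℝ W p := differentiableAt_curvedWeb hΓ hpl hk hG
  have hc : DifferentiableAt ℝ (fun q => fderiv ℝ F (W q)) p := (hDF _).comp p hWd
  have hVq : HasFDerivAt (fun q : ℝ × ℝ => V q.1) ((ContinuousLinearMap.smulRight (1 : ℝ →L[ℝ] ℝ) V').comp (ContinuousLinearMap.fst ℝ ℝ ℝ)) p :=
    hV.hasFDerivAt.comp p hasFDerivAt_fst
  have hu : DifferentiableAt ℝ (fun q : ℝ × ℝ => V q.1) p := hVq.differentiableAt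
  rw [fderiv_clm_apply hc hu]
  simp only [_root_.add_apply, ContinuousLinearMap.comp_apply, ContinuousLinearMap.flip_apply]
  rw [hVq.fderiv]
  have hcW : fderiv ℝ (fun q => fderiv ℝ F (W q)) p h = fderiv ℝ (fderiv ℝ F) (W p) (fderiv ℝ W p h) := by
    rw [show (fun q => fderiv ℝ F (W q)) = fderiv ℝ F ∘ W from rfl, fderiv_comp p (hDF _) hWd]
    rfl
  rw [hcW, hW, fderiv_curvedWeb_apply hΓ hpl hk hG h]
  simp only [ContinuousLinearMap.comp_apply, ContinuousLinearMap.coe_fst', ContinuousLinearMap.smulRight_apply,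
    ContinuousLinearMap.one_def, ContinuousLinearMap.id_apply, map_smul, smul_eq_mul]
  ring

end web

/-! ### Part C — the identity -/

/-- ★ **THE CURVED HUYGENS IDENTITY.**  For `F ∈ C³`, a `C²` unit-speed planar branch `Γ` with `Γ″ = k•JΓ′`, a web function `G` differentiable on the open region
`ℝ × I`, and the six web identities along `W(s,z) = Γ(s) + G(s,z)JΓ′(s) + z e₂` (`∂_{JΓ′}F(W) = ∂_{Γ′}F(W) = 0`, `F(W) = R(z)` with `R ∈ C²` on `I`, ridge law
`B(Γ′,Γ′) + B(JΓ′,JΓ′) = −κ(z)`, slice law `B(e₂,e₂) = −μ(z)(B(Γ′,Γ′) + B(JΓ′,JΓ′))`, `B = D²F(W)`):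
`κ(z)·(1 − k(s)G)²·(DG[(0,1)])² = (R″(z) − μ(z)κ(z))·((1 − k(s)G)² + (DG[(1,0)])²)`. -/
theorem curved_huygens_identity {F : EuclideanSpace ℝ (Fin 3) → ℝ} (hF : ContDiff ℝ 3 F)
    {Γ : ℝ → EuclideanSpace ℝ (Fin 3)} (hΓ : ContDiff ℝ 2 Γ) (hpl : ∀ s, Γ s 2 = 0)
    {k : ℝ → ℝ} (hk : ∀ s, deriv (deriv Γ) s = k s • rotJ (deriv Γ s))
    {I : Set ℝ} (hI : IsOpen I) {G : ℝ × ℝ → ℝ} (hG : ∀ p ∈ region I, DifferentiableAt ℝ G p)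
    {R κ μ : ℝ → ℝ} (hR : ∀ z ∈ I, HasDerivAt (deriv R) (deriv (deriv R) z) z)
    (hR1 : ∀ z ∈ I, DifferentiableAt ℝ R z)
    (hν : ∀ p ∈ region I, fderiv ℝ F (Γ p.1 + G p • rotJ (deriv Γ p.1) + p.2 • e2) (rotJ (deriv Γ p.1)) = 0)
    (hT : ∀ p ∈ region I, fderiv ℝ F (Γ p.1 + G p • rotJ (deriv Γ p.1) + p.2 • e2) (deriv Γ p.1) = 0)
    (hval : ∀ p ∈ region I, F (Γ p.1 + G p • rotJ (deriv Γ p.1) + p.2 • e2) = R p.2)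
    (hridge : ∀ p ∈ region I,
      fderiv ℝ (fderiv ℝ F) (Γ p.1 + G p • rotJ (deriv Γ p.1) + p.2 • e2) (deriv Γ p.1) (deriv Γ p.1) +
        fderiv ℝ (fderiv ℝ F) (Γ p.1 + G p • rotJ (deriv Γ p.1) + p.2 • e2) (rotJ (deriv Γ p.1)) (rotJ (deriv Γ p.1)) = -κ p.2)
    (hslice : ∀ p ∈ region I,
      fderiv ℝ (fderiv ℝ F) (Γ p.1 + G p • rotJ (deriv Γ p.1) + p.2 • e2) e2 e2 =
        -μ p.2 * (fderiv ℝ (fderiv ℝ F) (Γ p.1 + G p • rotJ (deriv Γ p.1) + p.2 • e2) (deriv Γ p.1) (deriv Γ p.1) +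
          fderiv ℝ (fderiv ℝ F) (Γ p.1 + G p • rotJ (deriv Γ p.1) + p.2 • e2) (rotJ (deriv Γ p.1)) (rotJ (deriv Γ p.1))))
    {p : ℝ × ℝ} (hp : p ∈ region I) :
    κ p.2 * (1 - k p.1 * G p) ^ 2 * (fderiv ℝ G p (0, 1)) ^ 2 =
      (deriv (deriv R) p.2 - μ p.2 * κ p.2) * ((1 - k p.1 * G p) ^ 2 + (fderiv ℝ G p (1, 0)) ^ 2) := by
  set W : ℝ × ℝ → EuclideanSpace ℝ (Fin 3) := fun q => Γ q.1 + G q • rotJ (deriv Γ q.1) + q.2 • e2 with hW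
  set x := W p with hx
  set B := fderiv ℝ (fderiv ℝ F) x with hB
  set T := deriv Γ p.1 with hTdef
  set ν := rotJ (deriv Γ p.1) with hνdef
  set J := 1 - k p.1 * G p with hJ
  have hF1 : Differentiable ℝ F := hF.differentiable (by norm_num)
  have hF2 : ContDiff ℝ 2 F := hF.of_le (by norm_num)
  have hDF : ∀ y, DifferentiableAt ℝ (fderiv ℝ F) y := fun y =>
    ((hF.fderiv_right (m := 2) (by norm_num)).differentiable (by norm_num)) y
  have hsymm : ∀ a c : EuclideanSpace ℝ (Fin 3), B a c = B c a := fun a c =>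
    (hF2.contDiffAt.isSymmSndFDerivAt (by simp)) a c
  have hGp := hG p hp
  have hTd : HasDerivAt (deriv Γ) (k p.1 • rotJ (deriv Γ p.1)) p.1 := by
    have h := (hasDerivAt_of_contDiff_two hΓ p.1).2; rwa [hk p.1] at h
  have hNd : HasDerivAt (fun t => rotJ (deriv Γ t)) (-(k p.1) • deriv Γ p.1) p.1 := hasDerivAt_normal hΓ hpl hk p.1
  -- (I1) `∂_νF(W) ≡ 0` differentiated in `s` and in `z` (the turning term `−k h₁ ∂_TF(W)` vanishes by `hT`)
  -- the two criticality identities at `p`, in expanded form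
  have hT0 : fderiv ℝ F (Γ p.1 + G p • rotJ (deriv Γ p.1) + p.2 • e2) (deriv Γ p.1) = 0 := hT p hp
  have hν0 : fderiv ℝ F (Γ p.1 + G p • rotJ (deriv Γ p.1) + p.2 • e2) (rotJ (deriv Γ p.1)) = 0 := hν p hp
  have I1s : J * B T ν + fderiv ℝ G p (1, 0) * B ν ν = 0 := by
    have h := fderiv_eq_zero_of_eqOn_region hI hν hp (1, 0)
    rw [fderiv_moving_deriv hΓ hpl hk hGp hF2 hNd] at h
    simp only [map_add, map_smul, _root_.add_apply, _root_.smul_apply, smul_eq_mul] at h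
    simp only [hB, hJ, hTdef, hνdef, hx, hW]
    linear_combination h + k p.1 * hT0
  have I1z : fderiv ℝ G p (0, 1) * B ν ν + B e2 ν = 0 := by
    have h := fderiv_eq_zero_of_eqOn_region hI hν hp (0, 1)
    rw [fderiv_moving_deriv hΓ hpl hk hGp hF2 hNd] at h
    simp only [map_add, map_smul, _root_.add_apply, _root_.smul_apply, smul_eq_mul] at h
    simp only [hB, hνdef, hx, hW]
    linear_combination h
  -- (I2) `∂_TF(W) ≡ 0` differentiated in `s` (the turning term `k h₁ ∂_νF(W)` vanishes by `hν`)
  have I2s : J * B T T + fderiv ℝ G p (1, 0) * B ν T = 0 := by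
    have h := fderiv_eq_zero_of_eqOn_region hI hT hp (1, 0)
    rw [fderiv_moving_deriv hΓ hpl hk hGp hF2 hTd] at h
    simp only [map_add, map_smul, _root_.add_apply, _root_.smul_apply, smul_eq_mul] at h
    simp only [hB, hJ, hTdef, hνdef, hx, hW]
    linear_combination h - k p.1 * hν0
  -- (I3) `F(W) = R(z)` differentiated in `z`: `∂_{e₂}F(W) = R′(z)` on the region, then once more
  have I3a : ∀ q ∈ region I, fderiv ℝ F (W q) e2 = deriv R q.2 := by
    intro q hq
    have hGq := hG q hq
    have hd : fderiv ℝ (fun q' => F (W q')) q (0, 1) = fderiv ℝ (fun q' : ℝ × ℝ => R q'.2) q (0, 1) := by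
      have hev : (fun q' => F (W q')) =ᶠ[𝓝 q] fun q' : ℝ × ℝ => R q'.2 :=
        Filter.eventuallyEq_of_mem ((isOpen_region hI).mem_nhds hq) fun q' hq' => hval q' hq'
      rw [hev.fderiv_eq]
    rw [hW, fderiv_comp_curvedWeb hΓ hpl hk hGq (hF1 _) (0, 1)] at hd
    have hRd : fderiv ℝ (fun q' : ℝ × ℝ => R q'.2) q (0, 1) = deriv R q.2 := by
      have hc : HasFDerivAt (fun q' : ℝ × ℝ => R q'.2)
          ((fderiv ℝ R q.2).comp (ContinuousLinearMap.snd ℝ ℝ ℝ)) q :=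
        HasFDerivAt.comp q (hR1 q.2 hq).hasFDerivAt hasFDerivAt_snd
      rw [hc.fderiv]
      simp
    rw [hRd] at hd
    have hlin : fderiv ℝ F (W q) ((((0 : ℝ), (1 : ℝ)).1 * (1 - k q.1 * G q)) • deriv Γ q.1 + fderiv ℝ G q (0, 1) • rotJ (deriv Γ q.1) +
        ((0 : ℝ), (1 : ℝ)).2 • e2) = fderiv ℝ G q (0, 1) * fderiv ℝ F (W q) (rotJ (deriv Γ q.1)) + fderiv ℝ F (W q) e2 := by
      simp [map_add, map_smul, smul_eq_mul]
    rw [hlin, hν q hq, mul_zero, zero_add] at hd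
    exact hd
  have I3 : fderiv ℝ G p (0, 1) * B e2 ν + B e2 e2 = deriv (deriv R) p.2 := by
    have hφ : ∀ q ∈ region I, (fun q => fderiv ℝ F (W q) e2 - deriv R q.2) q = 0 := fun q hq => by
      simp [I3a q hq]
    have h := fderiv_eq_zero_of_eqOn_region hI hφ hp (0, 1)
    have hd1 : DifferentiableAt ℝ (fun q => fderiv ℝ F (W q) e2) p :=
      ((hDF _).clm_apply (differentiableAt_const e2)).comp p (differentiableAt_curvedWeb hΓ hpl hk hGp)
    have hd2 : DifferentiableAt ℝ (fun q : ℝ × ℝ => deriv R q.2) p := (hR p.2 hp).differentiableAt.comp p differentiableAt_snd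
    rw [fderiv_fun_sub hd1 hd2] at h
    have hRd : fderiv ℝ (fun q : ℝ × ℝ => deriv R q.2) p (0, 1) = deriv (deriv R) p.2 := by
      have hc : HasFDerivAt (fun q' : ℝ × ℝ => deriv R q'.2)
          ((ContinuousLinearMap.smulRight (1 : ℝ →L[ℝ] ℝ) (deriv (deriv R) p.2)).comp (ContinuousLinearMap.snd ℝ ℝ ℝ)) p :=
        (hR p.2 hp).hasFDerivAt.comp p hasFDerivAt_snd
      rw [hc.fderiv]
      simp
    have hce2 : fderiv ℝ (fun q => fderiv ℝ F (W q) e2) p (0, 1) = fderiv ℝ G p (0, 1) * B ν e2 + B e2 e2 := by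
      have h0 := fderiv_moving_deriv hΓ hpl hk hGp hF2 (V := fun _ => e2) (V' := 0) (hasDerivAt_const p.1 e2) (0, 1)
      rw [hW, h0]
      simp only [map_add, map_smul, map_zero, _root_.add_apply, _root_.smul_apply, smul_eq_mul, mul_zero, add_zero,
        zero_mul, zero_smul, zero_add, one_smul]
      simp only [hB, hνdef, hx, hW]
    rw [_root_.sub_apply, hce2, hRd, hsymm ν e2] at h
    linarith
  -- assemble
  have hr := hridge p hp
  have hsl := hslice p hp
  exact curved_huygens_algebra (b := B ν ν) (Btn := B T ν) (Bzn := B e2 ν) (Btt := B T T) (Bzz := B e2 e2)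
    (Gs := fderiv ℝ G p (1, 0)) (Gz := fderiv ℝ G p (0, 1)) (J := J) (κ := κ p.2) (μ := μ p.2) (R2 := deriv (deriv R) p.2)
    I1s (by linear_combination I1z) (by rw [hsymm ν T] at I2s; exact I2s) hr I3 hsl

end Summit.NavierStokesRegularity.NavierStokesRegularity.Theorems.PoloidalWindowDoorLrcModEntireCurvedWebHuygens
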